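import Mathlib.RingTheory.Ideal.Height
import Mathlib.RingTheory.Ideal.KrullsHeightTheorem
import Mathlib.RingTheory.Ideal.MinimalPrime.Basic
import Mathlib.RingTheory.KrullDimension.Basic
import Literature.RingTheory.TightClosure.TightClosure
import HarnessLib

/-!
# A prime is minimal over the head of a system of parameters (crux `FrobeniusLadder.FInjectiveMacaulayfication`, line `Sketch`)

Stub `stub_sopThroughPrime` of the skeleton `Sketch` for crux stmt-ResolutionOfSingularities-15315 (route
`FrobeniusLadder`; cycle-4 wave 2, "the clause localizes"). The dimension-theoretic input: in a
Noetherian local ring `(R, 𝔪)` of dimension `d`, every prime `P` of height `h` contains the first `h`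
members `x` of some system of parameters `(x, t)` of `R` (in the tree's sense
`Literature.RingTheory.TightClosure.IsSystemOfParameters`: `dim R = h + e` and `rad (x, t) = 𝔪`) and
is a minimal prime of `(x)`.

Proof [folklore; Bruns–Herzog A.2–A.4, Matsumura Thm. 14.1 (proof)]. Heights are finite (Krull's
height theorem, `Ideal.finiteHeight_of_isNoetherianRing`), so `h = ht P ≤ d = ht 𝔪 = dim R`; write
`d = h + e`. The engine is one PRIME AVOIDANCE step
(`exists_mem_le_height_sup_span_singleton`): if every minimal prime of `J` has height `≥ r` (i.e.
`r ≤ ht J`) and `r < ht I`, some `y ∈ I` avoids the finitely many minimal primes of `J` of height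
exactly `r` (none contains `I`, by monotonicity of height), and then every minimal prime `Q` of
`J + (y)` has height `≥ r + 1` — otherwise `ht Q = r`, so `Q` is minimal over `J`
(`Ideal.mem_minimalPrimes_of_height_eq`) of height `r` and contains `y`. Iterating
(`exists_forall_mem_and_le_height`) `h` times inside `P` from `J = ⊥` gives `x ⊆ P` with `h ≤ ht (x)`,
whence `P` is minimal over `(x)` (`ht P = h ≤ ht (x)`); iterating `e` more times inside `𝔪` from
`J = (x)` gives `t ⊆ 𝔪` with `h + e ≤ ht (x, t)`, whence `𝔪` is minimal over `(x, t) ≤ 𝔪`, i.e.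
`(x, t)` is a system of parameters (`isSystemOfParameters_iff_mem_minimalPrimes`). No named facts.
-/

-- single-problem summit: the doubled namespace component is forced
set_option linter.dupNamespace false

open Literature.RingTheory.TightClosure IsLocalRing

namespace Summit.ResolutionOfSingularities.ResolutionOfSingularities.Theorems.FInjectiveMacaulayfication.SopThroughPrime

variable {R : Type*} [CommRing R]

section Noetherian

variable [IsNoetherianRing R]

/-- **The prime avoidance step.** In a Noetherian ring, if `r ≤ ht J` (every minimal prime of `J` has
height `≥ r`) and `r < ht I`, then some `y ∈ I` has `r + 1 ≤ ht (J + (y))`: choose `y` outside the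
finitely many minimal primes of `J` of height exactly `r` (none of them contains `I`); a minimal prime
`Q` of `J + (y)` of height `r` would be a minimal prime of `J` of height `r` containing `y`. [folklore] -/
theorem exists_mem_le_height_sup_span_singleton (I J : Ideal R) (r : ℕ)
    (hJ : (r : ℕ∞) ≤ J.height) (hI : (r : ℕ∞) < I.height) :
    ∃ y ∈ I, (r : ℕ∞) + 1 ≤ (J ⊔ Ideal.span {y}).height := by
  -- the minimal primes of `J` of height exactly `r`
  set S : Set (Ideal R) := {K | K ∈ J.minimalPrimes ∧ K.height = r} with hS
  have hSfin : S.Finite := J.finite_minimalPrimes_of_isNoetherianRing.subset fun _ h => h.1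
  -- prime avoidance: `I ⊄ ⋃ S`
  have havoid : ¬ ((I : Set R) ⊆ ⋃ K ∈ S, (K : Set R)) := by
    rw [Ideal.subset_union_prime_finite hSfin I I (fun K hK _ _ => hK.1.1.1)]
    rintro ⟨K, hKS, hle⟩
    have h := hI.trans_le (Ideal.height_mono hle)
    rw [hKS.2] at h
    exact lt_irrefl _ h
  obtain ⟨y, hyI, hy⟩ := Set.not_subset.mp havoid
  have hy' : ∀ K ∈ S, y ∉ K := fun K hK hyK => hy (Set.mem_biUnion hK hyK)
  refine ⟨y, hyI, ?_⟩
  rw [(J ⊔ Ideal.span {y}).height_eq_inf_minimalPrimes]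
  refine le_iInf₂ fun Q hQ => ?_
  have hQp : Q.IsPrime := hQ.1.1
  have hJQ : J ≤ Q := le_sup_left.trans hQ.1.2
  have hyQ : y ∈ Q := hQ.1.2 (Ideal.mem_sup_right (Ideal.mem_span_singleton_self y))
  have hrQ : (r : ℕ∞) ≤ Q.height := hJ.trans (Ideal.height_mono hJQ)
  rcases hrQ.lt_or_eq with hlt | heq
  · exact Order.add_one_le_of_lt hlt
  · -- `ht Q = r`: `Q` is a minimal prime of `J` of height `r` containing `y`
    exact absurd hyQ (hy' Q ⟨Ideal.mem_minimalPrimes_of_height_eq hJQ (heq.ge.trans hJ), heq.symm⟩)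

/-- **Iterated prime avoidance.** In a Noetherian ring, if `r ≤ ht J` and `r + e ≤ ht I`, then there
are `t₁, …, tₑ ∈ I` with `r + e ≤ ht (J + (t₁, …, tₑ))` (induction on `e`, one
`exists_mem_le_height_sup_span_singleton` step at a time). [folklore] -/
theorem exists_forall_mem_and_le_height (I J : Ideal R) (r : ℕ) (hJ : (r : ℕ∞) ≤ J.height) :
    ∀ e : ℕ, ((r + e : ℕ) : ℕ∞) ≤ I.height →
      ∃ t : Fin e → R, (∀ j, t j ∈ I) ∧
        ((r + e : ℕ) : ℕ∞) ≤ (J ⊔ Ideal.span (Set.range t)).height := by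
  intro e
  induction e with
  | zero =>
    intro _
    refine ⟨Fin.elim0, fun j => j.elim0, ?_⟩
    rw [Set.range_eq_empty, Ideal.span_empty, sup_bot_eq, Nat.add_zero]
    exact hJ
  | succ e ih =>
    intro hI
    have hlt : ((r + e : ℕ) : ℕ∞) < I.height := by
      refine lt_of_lt_of_le ?_ hI
      exact_mod_cast Nat.lt_succ_self (r + e)
    obtain ⟨t, htI, ht⟩ := ih hlt.le
    obtain ⟨y, hyI, hy⟩ :=
      exists_mem_le_height_sup_span_singleton I (J ⊔ Ideal.span (Set.range t)) (r + e) ht hlt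
    refine ⟨Fin.snoc t y, fun j => ?_, ?_⟩
    · refine Fin.lastCases ?_ (fun j => ?_) j
      · rw [Fin.snoc_last]
        exact hyI
      · rw [Fin.snoc_castSucc]
        exact htI j
    · rw [Fin.range_snoc, Ideal.span_insert, sup_comm (Ideal.span {y}), ← sup_assoc,
        ← add_assoc, Nat.cast_succ]
      exact hy

end Noetherian

/-- **A prime is minimal over the head of a system of parameters.** In a Noetherian local ring `R`,
every prime `P` contains the first `h = ht P` members `x` of some system of parameters
`Fin.append x t` of `R` and is a minimal prime of `(x)`: choose `x₁, x₂, … ∈ P` successively outside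
the minimal primes of height `l` of the ideal generated by the first `l` of them (prime avoidance,
possible while `l < ht P`), then continue inside `𝔪` up to `d = dim R` elements; all minimal primes of
`(x₁, …, x_d)` have height `d`, so it is `𝔪`-primary, and `P ⊇ (x₁, …, x_h)` with
`ht P = h ≤ ht (x₁, …, x_h)` is minimal over it. [folklore] -/
theorem stub_sopThroughPrime : ∀ (R : Type) [CommRing R] [IsNoetherianRing R] [IsLocalRing R]
    (P : Ideal R) [P.IsPrime], ∃ (h e : ℕ) (x : Fin h → R) (t : Fin e → R),
      Literature.RingTheory.TightClosure.IsSystemOfParameters (Fin.append x t) ∧ (∀ i, x i ∈ P) ∧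
      P ∈ (Ideal.span (Set.range x)).minimalPrimes ∧ P.height = h := by
  intro R _ _ _ P _
  -- finite heights: `h = ht P ≤ ht 𝔪 = dim R = h + e`
  obtain ⟨h, hh⟩ := ENat.ne_top_iff_exists.mp (Ideal.height_ne_top_of_isPrime (I := P))
  obtain ⟨d, hd⟩ :=
    ENat.ne_top_iff_exists.mp (Ideal.height_ne_top_of_isPrime (I := maximalIdeal R))
  have hPm : P ≤ maximalIdeal R := le_maximalIdeal (Ideal.IsPrime.ne_top ‹_›)
  have hhd : h ≤ d := by
    have hle := Ideal.height_mono hPm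
    rw [← hh, ← hd] at hle
    exact_mod_cast hle
  obtain ⟨e, rfl⟩ := Nat.exists_eq_add_of_le hhd
  have hdim : ringKrullDim R = ((h + e : ℕ) : WithBot ℕ∞) := by
    rw [← maximalIdeal_height_eq_ringKrullDim, ← hd]
    rfl
  -- the head `x ⊆ P`: `h` prime avoidance steps inside `P`, starting from `⊥`
  obtain ⟨x, hxP, hx⟩ :=
    exists_forall_mem_and_le_height P ⊥ 0 (by simp) h (by rw [Nat.zero_add, hh])
  rw [Nat.zero_add, bot_sup_eq] at hx
  have hxle : Ideal.span (Set.range x) ≤ P := Ideal.span_le.mpr (Set.range_subset_iff.mpr hxP)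
  have hPmin : P ∈ (Ideal.span (Set.range x)).minimalPrimes :=
    Ideal.mem_minimalPrimes_of_height_eq hxle (hh.ge.trans hx)
  -- the tail `t ⊆ 𝔪`: `e` more prime avoidance steps inside `𝔪`, starting from `(x)`
  obtain ⟨t, htm, ht⟩ :=
    exists_forall_mem_and_le_height (maximalIdeal R) (Ideal.span (Set.range x)) h hx e hd.le
  refine ⟨h, e, x, t, ?_, hxP, hPmin, hh.symm⟩
  -- `(x, t) ≤ 𝔪` has height `≥ h + e = ht 𝔪`, so `𝔪` is minimal over it: a system of parameters
  rw [isSystemOfParameters_iff_mem_minimalPrimes]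
  refine ⟨hdim, ?_⟩
  -- the range of an appended family (`range_fin_append` of `AlterationsEnlargingZ.lean`,
  -- re-proved locally to keep the imports small)
  have range_fin_append' : Set.range (Fin.append x t) = Set.range x ∪ Set.range t := by
    ext a
    constructor
    · rintro ⟨i, rfl⟩
      refine Fin.addCases (fun j => ?_) (fun j => ?_) i
      · exact Or.inl ⟨j, (Fin.append_left x t j).symm⟩
      · exact Or.inr ⟨j, (Fin.append_right x t j).symm⟩
    · rintro (⟨j, rfl⟩ | ⟨j, rfl⟩)
      · exact ⟨Fin.castAdd e j, Fin.append_left x t j⟩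
      · exact ⟨Fin.natAdd h j, Fin.append_right x t j⟩
  rw [range_fin_append', Ideal.span_union]
  refine Ideal.mem_minimalPrimes_of_height_eq ?_ (hd.symm.le.trans ht)
  exact sup_le (hxle.trans hPm) (Ideal.span_le.mpr (Set.range_subset_iff.mpr htm))

end Summit.ResolutionOfSingularities.ResolutionOfSingularities.Theorems.FInjectiveMacaulayfication.SopThroughPrime
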